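import Summits.HodgeConjecture.HodgeConjecture.Theorems.PadicSemiregularLiftHodgeFermatVarietiesFiveQSymmetric
import HarnessLib

/-!
# Hodge sextuples of level `5q`, IV: the occupied fibre — line `cancel-by-any-claim-lattice`, crux `HodgeFermatVarieties` (stmt-HodgeConjecture-1334)

Fifth file of lead c3's level-`5q` programme (prime `q ≥ 7`): the second alternative of `structure_units`.
Let `s` be a Hodge SEXTUPLE of `ℤ/5q` and `b₁ ∈ (ℤ/q)ˣ` a residue whose whole fibre `F = {x unit : x ≡ b₁ (q)}`
(four elements) is occupied, `c(x) ≥ c(-x) + 1` on `F`, and `c(x) = c(-x)` for the units off the fibres of `±b₁`.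

* `fibre_le` — `F ≤ s` as multisets, so `s = F + s'` with `#s' = 2` (`exists_eq_fibre_add_pair`);
* `casts_sum_fibre` — `Σ F ≡ 0 (mod 5)` and `≡ 4 b₁ (mod q)`;
* `pair_level_q` — the two remaining entries `y, z` are of level `q` (zero mod `5`, non-zero mod `q`) with
  `ȳ + z̄ = -4 b₁`: every other configuration contradicts the vanishing of `Σ s`, the congruences mod `q`
  (`2 b₁, 4 b₁, 6 b₁ ≠ 0` as `q ≥ 7`) or the symmetry of the multiplicities off the fibres of `±b₁`.

The identification of `{ȳ, z̄}` with `{b₁, -5 b₁}` by the relation (II), and the assembly into Aoki's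
`5`-standard multiset, are in the sequel `…FiveQClassification`.

References: [Aoki1983] N. Aoki, Math. Ann. 266 (1983) Thm A′ (§7); [Aoki1987] J. Math. Soc. Japan 39 (1987)
§1 (standard elements).
-/

set_option linter.dupNamespace false

noncomputable section

open Finset
open Literature.AlgebraicGeometry.HodgeTheory Literature.AlgebraicGeometry.HodgeTheory.FermatCharacter

namespace Summit.HodgeConjecture.HodgeConjecture.Theorems.CancelByAnyClaimLattice.FiveQ

section Level5q

variable {q : ℕ} [Fact q.Prime]

/-! ### §1 The occupied fibre as a sub-multiset -/

/-- The fibre of `b₁` as a multiset of residues: `{x unit : x ≡ b₁ (q)}` (four elements). [folklore] -/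
theorem card_fibreMultiset (hq : 7 ≤ q) (b₁ : (ZMod q)ˣ) :
    Multiset.card ((univ.filter fun x : (ZMod (5 * q))ˣ ↦ ZMod.unitsMap (dvd_mul_left q 5) x = b₁).val.map
      (fun x : (ZMod (5 * q))ˣ ↦ (x : ZMod (5 * q)))) = 4 := by
  rw [Multiset.card_map, Finset.card_val, card_fibre (five_ne hq) b₁]

/-- Multiplicities of the fibre multiset: `1` at the units of the fibre, `0` elsewhere. [folklore] -/
theorem count_fibreMultiset (b₁ : (ZMod q)ˣ) (y : ZMod (5 * q)) :
    Multiset.count y ((univ.filter fun x : (ZMod (5 * q))ˣ ↦ ZMod.unitsMap (dvd_mul_left q 5) x = b₁).val.map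
      (fun x : (ZMod (5 * q))ˣ ↦ (x : ZMod (5 * q)))) =
      if ∃ x : (ZMod (5 * q))ˣ, (x : ZMod (5 * q)) = y ∧ ZMod.unitsMap (dvd_mul_left q 5) x = b₁ then 1 else 0 := by
  classical
  split_ifs with h
  · obtain ⟨x, rfl, hx⟩ := h
    rw [Multiset.count_map_eq_count' _ _ Units.val_injective, Multiset.count_eq_one_of_mem]
    · exact Finset.nodup _
    · simp [hx]
  · rw [Multiset.count_eq_zero]
    intro hy
    obtain ⟨x, hx, rfl⟩ := Multiset.mem_map.mp hy
    simp only [Finset.mem_val, mem_filter, mem_univ, true_and] at hx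
    exact h ⟨x, rfl, hx⟩

/-- **The occupied fibre is a sub-multiset of `s`.** [folklore] -/
theorem fibre_le {s : Multiset (ZMod (5 * q))} {b₁ : (ZMod q)ˣ}
    (hocc : ∀ x : (ZMod (5 * q))ˣ, ZMod.unitsMap (dvd_mul_left q 5) x = b₁ →
      Multiset.count (-(x : ZMod (5 * q))) s + 1 ≤ Multiset.count (x : ZMod (5 * q)) s) :
    (univ.filter fun x : (ZMod (5 * q))ˣ ↦ ZMod.unitsMap (dvd_mul_left q 5) x = b₁).val.map
      (fun x : (ZMod (5 * q))ˣ ↦ (x : ZMod (5 * q))) ≤ s := by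
  classical
  rw [Multiset.le_iff_count]
  intro y
  rw [count_fibreMultiset]
  split_ifs with h
  · obtain ⟨x, rfl, hx⟩ := h
    have := hocc x hx
    omega
  · exact Nat.zero_le _

/-- **`s = F + {y, z}`.** [folklore] -/
theorem exists_eq_fibre_add_pair (hq : 7 ≤ q) {s : Multiset (ZMod (5 * q))} (h6 : Multiset.card s = 6)
    {b₁ : (ZMod q)ˣ}
    (hocc : ∀ x : (ZMod (5 * q))ˣ, ZMod.unitsMap (dvd_mul_left q 5) x = b₁ →
      Multiset.count (-(x : ZMod (5 * q))) s + 1 ≤ Multiset.count (x : ZMod (5 * q)) s) :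
    ∃ y z : ZMod (5 * q), s = (univ.filter fun x : (ZMod (5 * q))ˣ ↦ ZMod.unitsMap (dvd_mul_left q 5) x = b₁).val.map
      (fun x : (ZMod (5 * q))ˣ ↦ (x : ZMod (5 * q))) + {y, z} := by
  obtain ⟨t, ht⟩ := Multiset.le_iff_exists_add.mp (fibre_le hocc)
  have hcard : Multiset.card t = 2 := by
    have := congrArg Multiset.card ht
    rw [Multiset.card_add, card_fibreMultiset hq, h6] at this
    omega
  obtain ⟨y, z, rfl⟩ := Multiset.card_eq_two.mp hcard
  exact ⟨y, z, ht⟩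

/-! ### §2 The sum of the fibre -/

/-- **`Σ F ≡ 0 (mod 5)`** (the residues of the fibre run over `(ℤ/5)ˣ`, which sums to `0`) **and
`Σ F ≡ 4 b₁ (mod q)`**. [folklore] -/
theorem casts_sum_fibre (hq : 7 ≤ q) (b₁ : (ZMod q)ˣ) :
    ZMod.castHom (dvd_mul_right 5 q) (ZMod 5)
        (((univ.filter fun x : (ZMod (5 * q))ˣ ↦ ZMod.unitsMap (dvd_mul_left q 5) x = b₁).val.map
          (fun x : (ZMod (5 * q))ˣ ↦ (x : ZMod (5 * q)))).sum) = 0 ∧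
      ZMod.castHom (dvd_mul_left q 5) (ZMod q)
        (((univ.filter fun x : (ZMod (5 * q))ˣ ↦ ZMod.unitsMap (dvd_mul_left q 5) x = b₁).val.map
          (fun x : (ZMod (5 * q))ˣ ↦ (x : ZMod (5 * q)))).sum) = 4 * (b₁ : ZMod q) := by
  have hpq : (5 : ℕ) ≠ q := five_ne hq
  constructor
  · rw [_root_.map_multiset_sum, Multiset.map_map, ← Finset.sum_eq_multiset_sum]
    have h := sum_fibre_eq_sum_units hpq b₁ (fun a : (ZMod 5)ˣ ↦ ((a : (ZMod 5)ˣ) : ZMod 5))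
    have h' : ∑ x ∈ univ.filter (fun x : (ZMod (5 * q))ˣ ↦ ZMod.unitsMap (dvd_mul_left q 5) x = b₁),
        (ZMod.castHom (dvd_mul_right 5 q) (ZMod 5)) ((fun x : (ZMod (5 * q))ˣ ↦ (x : ZMod (5 * q))) x) =
        ∑ x ∈ univ.filter (fun x : (ZMod (5 * q))ˣ ↦ ZMod.unitsMap (dvd_mul_left q 5) x = b₁),
          ((ZMod.unitsMap (dvd_mul_right 5 q) x : (ZMod 5)ˣ) : ZMod 5) :=
      Finset.sum_congr rfl fun x _ ↦ by rw [coe_unitsMap]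
    rw [Function.comp_def, h', h]
    decide
  · rw [_root_.map_multiset_sum, Multiset.map_map, ← Finset.sum_eq_multiset_sum]
    have h' : ∀ x ∈ univ.filter (fun x : (ZMod (5 * q))ˣ ↦ ZMod.unitsMap (dvd_mul_left q 5) x = b₁),
        (ZMod.castHom (dvd_mul_left q 5) (ZMod q) ∘ fun x : (ZMod (5 * q))ˣ ↦ (x : ZMod (5 * q))) x = (b₁ : ZMod q) := by
      intro x hx
      simp only [mem_filter, mem_univ, true_and] at hx
      rw [Function.comp_apply, ← coe_unitsMap, hx]
    rw [Finset.sum_congr rfl h', Finset.sum_const, card_fibre hpq b₁, nsmul_eq_mul]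
    norm_num

/-! ### §3 The two remaining entries are of level `q` -/

/-- **Multiplicity of a unit in `s = F + {y, z}`.** [folklore] -/
theorem count_unit_eq {s : Multiset (ZMod (5 * q))} {b₁ : (ZMod q)ˣ} {y z : ZMod (5 * q)}
    (hs : s = (univ.filter fun x : (ZMod (5 * q))ˣ ↦ ZMod.unitsMap (dvd_mul_left q 5) x = b₁).val.map
      (fun x : (ZMod (5 * q))ˣ ↦ (x : ZMod (5 * q))) + {y, z}) (w : (ZMod (5 * q))ˣ) :
    Multiset.count (w : ZMod (5 * q)) s =
      (if ZMod.unitsMap (dvd_mul_left q 5) w = b₁ then 1 else 0) + Multiset.count (w : ZMod (5 * q)) {y, z} := by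
  classical
  rw [hs, Multiset.count_add, count_fibreMultiset]
  congr 1
  by_cases hw : ZMod.unitsMap (dvd_mul_left q 5) w = b₁
  · rw [if_pos hw, if_pos ⟨w, rfl, hw⟩]
  · rw [if_neg hw, if_neg]
    rintro ⟨x, hx, hxb⟩
    exact hw (by rw [← Units.val_injective hx]; exact hxb)

/-- `2 b₁ ≠ 0`, `4 b₁ ≠ 0`, `6 b₁ ≠ 0` in `ℤ/q` for a unit `b₁` and `q ≥ 7`. [folklore] -/
theorem small_mul_ne_zero (hq : 7 ≤ q) (b₁ : (ZMod q)ˣ) {k : ℕ} (hk0 : 0 < k) (hk : k < 7) :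
    (k : ZMod q) * (b₁ : ZMod q) ≠ 0 := by
  refine mul_ne_zero ?_ (Units.ne_zero b₁)
  rw [Ne, ZMod.natCast_eq_zero_iff]
  intro h
  have := Nat.le_of_dvd hk0 h
  omega

/-- **A unit entry outside the fibres of `±b₁` whose negative is not an entry is impossible** (its
multiplicity would be symmetric). Technical form used twice below. [folklore] -/
theorem false_of_unit_off (hq : 7 ≤ q) {s : Multiset (ZMod (5 * q))} {b₁ : (ZMod q)ˣ} {y z : ZMod (5 * q)}
    (hs : s = (univ.filter fun x : (ZMod (5 * q))ˣ ↦ ZMod.unitsMap (dvd_mul_left q 5) x = b₁).val.map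
      (fun x : (ZMod (5 * q))ˣ ↦ (x : ZMod (5 * q))) + {y, z})
    (hoff : ∀ x : (ZMod (5 * q))ˣ, ZMod.unitsMap (dvd_mul_left q 5) x ≠ b₁ → ZMod.unitsMap (dvd_mul_left q 5) x ≠ -b₁ →
      Multiset.count (x : ZMod (5 * q)) s = Multiset.count (-(x : ZMod (5 * q))) s)
    (hsum : ZMod.castHom (dvd_mul_left q 5) (ZMod q) y + ZMod.castHom (dvd_mul_left q 5) (ZMod q) z = -(4 * (b₁ : ZMod q)))
    (w : (ZMod (5 * q))ˣ) (hwy : (w : ZMod (5 * q)) = y)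
    (h1 : ZMod.unitsMap (dvd_mul_left q 5) w ≠ b₁) (h2 : ZMod.unitsMap (dvd_mul_left q 5) w ≠ -b₁) : False := by
  classical
  haveI : Fact (1 < 5 * q) := ⟨by omega⟩
  have hc := hoff w h1 h2
  rw [count_unit_eq hs w, if_neg h1, zero_add] at hc
  have hcw : 0 < Multiset.count (w : ZMod (5 * q)) ({y, z} : Multiset (ZMod (5 * q))) :=
    Multiset.count_pos.mpr (by simp [hwy])
  -- so `-w` occurs in `s`; it is a unit off the fibres of `±b₁`, hence in `{y, z}`, hence `-w = z`
  have hnw : ZMod.unitsMap (dvd_mul_left q 5) (-w) ≠ b₁ := by rw [unitsMap_neg]; exact fun h ↦ h2 (by rw [← h, neg_neg])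
  have hc' := count_unit_eq hs (-w)
  rw [if_neg hnw, zero_add, Units.val_neg] at hc'
  rw [hc'] at hc
  have hmem : -(w : ZMod (5 * q)) ∈ ({y, z} : Multiset (ZMod (5 * q))) := Multiset.count_pos.mp (by omega)
  simp only [Multiset.insert_eq_cons, Multiset.mem_cons, Multiset.mem_singleton] at hmem
  have hwz : -(w : ZMod (5 * q)) = z := by
    rcases hmem with h | h
    · -- `-w = y = w`: then `2w = 0`, impossible for a unit of odd modulus
      exfalso
      rw [← hwy] at h
      have h2 : (2 : ZMod (5 * q)) * (w : ZMod (5 * q)) = 0 := by linear_combination -h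
      have h2u : IsUnit (2 : ZMod (5 * q)) := by
        have : ((2 : ℕ) : ZMod (5 * q)) = 2 := by norm_cast
        rw [← this, ZMod.isUnit_iff_coprime, Nat.coprime_two_left]
        exact Nat.odd_mul.mpr ⟨by decide, (Fact.out : q.Prime).odd_of_ne_two (by omega)⟩
      exact (Units.ne_zero w) ((h2u.mul_right_eq_zero).mp h2)
    · exact h
  -- then `ȳ + z̄ = 0 ≠ -4 b₁`
  rw [← hwy, ← hwz, map_neg, add_neg_cancel] at hsum
  exact small_mul_ne_zero hq b₁ (k := 4) (by norm_num) (by norm_num) (by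
    rw [show ((4 : ℕ) : ZMod q) = 4 by norm_cast]; exact neg_eq_zero.mp hsum.symm)

/-- **The entry `y` of `s = F + {y, z}` is not a unit** (given the sum condition and the symmetry off the
fibres of `±b₁`). [folklore] -/
theorem not_isUnit_of_pair (hq : 7 ≤ q) {s : Multiset (ZMod (5 * q))} (hs0 : ∀ x ∈ s, x ≠ 0) {b₁ : (ZMod q)ˣ}
    {y z : ZMod (5 * q)}
    (hs : s = (univ.filter fun x : (ZMod (5 * q))ˣ ↦ ZMod.unitsMap (dvd_mul_left q 5) x = b₁).val.map
      (fun x : (ZMod (5 * q))ˣ ↦ (x : ZMod (5 * q))) + {y, z})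
    (hoff : ∀ x : (ZMod (5 * q))ˣ, ZMod.unitsMap (dvd_mul_left q 5) x ≠ b₁ → ZMod.unitsMap (dvd_mul_left q 5) x ≠ -b₁ →
      Multiset.count (x : ZMod (5 * q)) s = Multiset.count (-(x : ZMod (5 * q))) s)
    (hsum5 : ZMod.castHom (dvd_mul_right 5 q) (ZMod 5) y + ZMod.castHom (dvd_mul_right 5 q) (ZMod 5) z = 0)
    (hsum : ZMod.castHom (dvd_mul_left q 5) (ZMod q) y + ZMod.castHom (dvd_mul_left q 5) (ZMod q) z = -(4 * (b₁ : ZMod q))) :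
    ¬ IsUnit y := by
  classical
  have hpq : (5 : ℕ) ≠ q := five_ne hq
  intro hyu
  set w := hyu.unit with hw
  have hwy : (w : ZMod (5 * q)) = y := hyu.unit_spec
  -- `w` lies in the fibre of `b₁` or of `-b₁` (else `false_of_unit_off`)
  by_cases h1 : ZMod.unitsMap (dvd_mul_left q 5) w = b₁
  · -- then `z̄ = -4b₁ - b₁ = -5 b₁`; analyse `z`
    have hyq : ZMod.castHom (dvd_mul_left q 5) (ZMod q) y = b₁ := by rw [← hwy, ← coe_unitsMap, h1]
    have hzq : ZMod.castHom (dvd_mul_left q 5) (ZMod q) z = -(5 * (b₁ : ZMod q)) := by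
      rw [hyq] at hsum; linear_combination hsum
    have hz0 : z ≠ 0 := hs0 z (by rw [hs]; simp)
    rcases trichotomy hpq hz0 with hzu | ⟨hz5, -⟩ | ⟨-, hzq0⟩
    · -- `z` unit: in the fibre of `b₁` or `-b₁` or off them
      set v := hzu.unit with hv
      have hvz : (v : ZMod (5 * q)) = z := hzu.unit_spec
      by_cases g1 : ZMod.unitsMap (dvd_mul_left q 5) v = b₁
      · have : ZMod.castHom (dvd_mul_left q 5) (ZMod q) z = b₁ := by rw [← hvz, ← coe_unitsMap, g1]
        rw [this] at hzq
        exact small_mul_ne_zero hq b₁ (k := 6) (by norm_num) (by norm_num)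
          (by rw [show ((6 : ℕ) : ZMod q) = 6 by norm_cast]; linear_combination hzq)
      by_cases g2 : ZMod.unitsMap (dvd_mul_left q 5) v = -b₁
      · have : ZMod.castHom (dvd_mul_left q 5) (ZMod q) z = -(b₁ : ZMod q) := by
          rw [← hvz, ← coe_unitsMap, g2, Units.val_neg]
        rw [this] at hzq
        exact small_mul_ne_zero hq b₁ (k := 4) (by norm_num) (by norm_num)
          (by rw [show ((4 : ℕ) : ZMod q) = 4 by norm_cast]; linear_combination hzq)
      · -- `z` off the fibres: symmetric argument with the roles of `y`, `z` exchanged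
        have hs' : s = (univ.filter fun x : (ZMod (5 * q))ˣ ↦ ZMod.unitsMap (dvd_mul_left q 5) x = b₁).val.map
            (fun x : (ZMod (5 * q))ˣ ↦ (x : ZMod (5 * q))) + {z, y} := by rw [hs, Multiset.pair_comm]
        exact false_of_unit_off hq hs' hoff (by rw [add_comm]; exact hsum) v hvz g1 g2
    · -- `z` of level `q`: `z ≡ 0 (5)` forces `y ≡ 0 (5)`, but `y` is a unit
      rw [hz5, add_zero] at hsum5
      exact cast_ne_zero_of_isUnit' hyu hsum5
    · -- `z` of level `5`: `z̄ = 0 = -5 b₁`, impossible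
      rw [hzq0] at hzq
      exact small_mul_ne_zero hq b₁ (k := 5) (by norm_num) (by norm_num)
        (by rw [show ((5 : ℕ) : ZMod q) = 5 by norm_cast]; linear_combination hzq)
  by_cases h2 : ZMod.unitsMap (dvd_mul_left q 5) w = -b₁
  · have hyq : ZMod.castHom (dvd_mul_left q 5) (ZMod q) y = -(b₁ : ZMod q) := by
      rw [← hwy, ← coe_unitsMap, h2, Units.val_neg]
    have hzq : ZMod.castHom (dvd_mul_left q 5) (ZMod q) z = -(3 * (b₁ : ZMod q)) := by
      rw [hyq] at hsum; linear_combination hsum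
    have hz0 : z ≠ 0 := hs0 z (by rw [hs]; simp)
    rcases trichotomy hpq hz0 with hzu | ⟨hz5, -⟩ | ⟨-, hzq0⟩
    · set v := hzu.unit with hv
      have hvz : (v : ZMod (5 * q)) = z := hzu.unit_spec
      by_cases g1 : ZMod.unitsMap (dvd_mul_left q 5) v = b₁
      · have : ZMod.castHom (dvd_mul_left q 5) (ZMod q) z = b₁ := by rw [← hvz, ← coe_unitsMap, g1]
        rw [this] at hzq
        exact small_mul_ne_zero hq b₁ (k := 4) (by norm_num) (by norm_num)
          (by rw [show ((4 : ℕ) : ZMod q) = 4 by norm_cast]; linear_combination hzq)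
      by_cases g2 : ZMod.unitsMap (dvd_mul_left q 5) v = -b₁
      · have : ZMod.castHom (dvd_mul_left q 5) (ZMod q) z = -(b₁ : ZMod q) := by
          rw [← hvz, ← coe_unitsMap, g2, Units.val_neg]
        rw [this] at hzq
        exact small_mul_ne_zero hq b₁ (k := 2) (by norm_num) (by norm_num)
          (by rw [show ((2 : ℕ) : ZMod q) = 2 by norm_cast]; linear_combination hzq)
      · have hs' : s = (univ.filter fun x : (ZMod (5 * q))ˣ ↦ ZMod.unitsMap (dvd_mul_left q 5) x = b₁).val.map
            (fun x : (ZMod (5 * q))ˣ ↦ (x : ZMod (5 * q))) + {z, y} := by rw [hs, Multiset.pair_comm]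
        exact false_of_unit_off hq hs' hoff (by rw [add_comm]; exact hsum) v hvz g1 g2
    · rw [hz5, add_zero] at hsum5
      exact cast_ne_zero_of_isUnit' hyu hsum5
    · rw [hzq0] at hzq
      exact small_mul_ne_zero hq b₁ (k := 3) (by norm_num) (by norm_num)
        (by rw [show ((3 : ℕ) : ZMod q) = 3 by norm_cast]; linear_combination hzq)
  · exact false_of_unit_off hq hs hoff hsum w hwy h1 h2

/-- **THE TWO REMAINING ENTRIES ARE OF LEVEL `q`**: `y ≡ z ≡ 0 (mod 5)`, `ȳ, z̄ ≠ 0`, `ȳ + z̄ = -4 b₁`.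
[cite: Aoki1983, Thm. A′ (§7)] -/
theorem pair_level_q : ∀ {q : ℕ} [Fact q.Prime], 7 ≤ q → ∀ {s : Multiset (ZMod (5 * q))}, IsHodgeMultiset s →
    ∀ {b₁ : (ZMod q)ˣ} {y z : ZMod (5 * q)},
    s = (univ.filter fun x : (ZMod (5 * q))ˣ ↦ ZMod.unitsMap (dvd_mul_left q 5) x = b₁).val.map
      (fun x : (ZMod (5 * q))ˣ ↦ (x : ZMod (5 * q))) + {y, z} →
    (∀ x : (ZMod (5 * q))ˣ, ZMod.unitsMap (dvd_mul_left q 5) x ≠ b₁ → ZMod.unitsMap (dvd_mul_left q 5) x ≠ -b₁ →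
      Multiset.count (x : ZMod (5 * q)) s = Multiset.count (-(x : ZMod (5 * q))) s) →
    ZMod.castHom (dvd_mul_right 5 q) (ZMod 5) y = 0 ∧ ZMod.castHom (dvd_mul_right 5 q) (ZMod 5) z = 0 ∧
      ZMod.castHom (dvd_mul_left q 5) (ZMod q) y ≠ 0 ∧ ZMod.castHom (dvd_mul_left q 5) (ZMod q) z ≠ 0 ∧
      ZMod.castHom (dvd_mul_left q 5) (ZMod q) y + ZMod.castHom (dvd_mul_left q 5) (ZMod q) z = -(4 * (b₁ : ZMod q)) := by
  intro q _ hq s hs b₁ y z hsyz hoff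
  classical
  have hpq : (5 : ℕ) ≠ q := five_ne hq
  -- the sum of `s` vanishes: `y + z = -Σ F`
  have hsum0 : ((univ.filter fun x : (ZMod (5 * q))ˣ ↦ ZMod.unitsMap (dvd_mul_left q 5) x = b₁).val.map
      (fun x : (ZMod (5 * q))ˣ ↦ (x : ZMod (5 * q)))).sum + (y + z) = 0 := by
    have := hs.1.2
    rw [hsyz, Multiset.sum_add] at this
    simpa using this
  obtain ⟨hF5, hFq⟩ := casts_sum_fibre hq b₁
  have hsum5 : ZMod.castHom (dvd_mul_right 5 q) (ZMod 5) y + ZMod.castHom (dvd_mul_right 5 q) (ZMod 5) z = 0 := by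
    have := congrArg (ZMod.castHom (dvd_mul_right 5 q) (ZMod 5)) hsum0
    rw [map_add, map_add, hF5, map_zero, zero_add] at this
    exact this
  have hsumq : ZMod.castHom (dvd_mul_left q 5) (ZMod q) y + ZMod.castHom (dvd_mul_left q 5) (ZMod q) z = -(4 * (b₁ : ZMod q)) := by
    have := congrArg (ZMod.castHom (dvd_mul_left q 5) (ZMod q)) hsum0
    rw [map_add, map_add, hFq, map_zero] at this
    linear_combination this
  have hs0 := hs.1.1
  have hy : ¬ IsUnit y := not_isUnit_of_pair hq hs0 hsyz hoff hsum5 hsumq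
  have hsyz' : s = (univ.filter fun x : (ZMod (5 * q))ˣ ↦ ZMod.unitsMap (dvd_mul_left q 5) x = b₁).val.map
      (fun x : (ZMod (5 * q))ˣ ↦ (x : ZMod (5 * q))) + {z, y} := by rw [hsyz, Multiset.pair_comm]
  have hz : ¬ IsUnit z := not_isUnit_of_pair hq hs0 hsyz' hoff (by rw [add_comm]; exact hsum5)
    (by rw [add_comm]; exact hsumq)
  have hy0 : y ≠ 0 := hs0 y (by rw [hsyz]; simp)
  have hz0 : z ≠ 0 := hs0 z (by rw [hsyz]; simp)
  -- neither is of level `5`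
  rcases trichotomy hpq hy0 with hyu | ⟨hy5, hyq⟩ | ⟨hy5, hyq⟩
  · exact absurd hyu hy
  · rcases trichotomy hpq hz0 with hzu | ⟨hz5, hzq⟩ | ⟨hz5, hzq⟩
    · exact absurd hzu hz
    · exact ⟨hy5, hz5, hyq, hzq, hsumq⟩
    · -- `z` level `5`: then `y ≡ -z ≢ 0 (5)` — but `y ≡ 0 (5)`
      exfalso
      rw [hy5, zero_add] at hsum5
      exact hz5 hsum5
  · exfalso
    rcases trichotomy hpq hz0 with hzu | ⟨hz5, -⟩ | ⟨-, hzq⟩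
    · exact absurd hzu hz
    · rw [hz5, add_zero] at hsum5; exact hy5 hsum5
    · rw [hyq, hzq, zero_add] at hsumq
      exact small_mul_ne_zero hq b₁ (k := 4) (by norm_num) (by norm_num)
        (by rw [show ((4 : ℕ) : ZMod q) = 4 by norm_cast]; exact neg_eq_zero.mp hsumq.symm)

end Level5q

end Summit.HodgeConjecture.HodgeConjecture.Theorems.CancelByAnyClaimLattice.FiveQ
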